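import Summits.Ventures.PackingBounds.Configurations.Dim22Card891Data

/-!
# The 891-point sharp configuration on `S²¹` as an explicit section of the Leech lattice: `A(22, arccos 1/4) = 891` and the ground-state energy — kernel checks, part C

Framing: lottery ticket; floor = certified bounds/negative ranges. Histogram chunks `19`–`29` of
the configuration of `Configurations/Dim22Card891Data` (see there and `Configurations/Dim22Card891`).
-/

namespace Summit.Ventures.PackingBounds.Config.Dim22Card891

open Summit.Ventures.PackingBounds.Config

set_option maxRecDepth 100000 in
/-- Kernel check (distance distribution), rows of chunk `19` against the whole configuration. -/
theorem hist_19 : histOK vecs891 table891 vecs891c19 = true := by decide +kernel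

set_option maxRecDepth 100000 in
/-- Kernel check (distance distribution), rows of chunk `20` against the whole configuration. -/
theorem hist_20 : histOK vecs891 table891 vecs891c20 = true := by decide +kernel

set_option maxRecDepth 100000 in
/-- Kernel check (distance distribution), rows of chunk `21` against the whole configuration. -/
theorem hist_21 : histOK vecs891 table891 vecs891c21 = true := by decide +kernel

set_option maxRecDepth 100000 in
/-- Kernel check (distance distribution), rows of chunk `22` against the whole configuration. -/
theorem hist_22 : histOK vecs891 table891 vecs891c22 = true := by decide +kernel

set_option maxRecDepth 100000 in
/-- Kernel check (distance distribution), rows of chunk `23` against the whole configuration. -/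
theorem hist_23 : histOK vecs891 table891 vecs891c23 = true := by decide +kernel

set_option maxRecDepth 100000 in
/-- Kernel check (distance distribution), rows of chunk `24` against the whole configuration. -/
theorem hist_24 : histOK vecs891 table891 vecs891c24 = true := by decide +kernel

set_option maxRecDepth 100000 in
/-- Kernel check (distance distribution), rows of chunk `25` against the whole configuration. -/
theorem hist_25 : histOK vecs891 table891 vecs891c25 = true := by decide +kernel

set_option maxRecDepth 100000 in
/-- Kernel check (distance distribution), rows of chunk `26` against the whole configuration. -/
theorem hist_26 : histOK vecs891 table891 vecs891c26 = true := by decide +kernel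

set_option maxRecDepth 100000 in
/-- Kernel check (distance distribution), rows of chunk `27` against the whole configuration. -/
theorem hist_27 : histOK vecs891 table891 vecs891c27 = true := by decide +kernel

set_option maxRecDepth 100000 in
/-- Kernel check (distance distribution), rows of chunk `28` against the whole configuration. -/
theorem hist_28 : histOK vecs891 table891 vecs891c28 = true := by decide +kernel

set_option maxRecDepth 100000 in
/-- Kernel check (distance distribution), rows of chunk `29` against the whole configuration. -/
theorem hist_29 : histOK vecs891 table891 vecs891c29 = true := by decide +kernel

end Summit.Ventures.PackingBounds.Config.Dim22Card891
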